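import Summits.CriticalPhenomena.SAWScalingLimit.Theorems.SAWTotalPositivityCriticalBubbleBoundJoinDefs
import Summits.CriticalPhenomena.SAWScalingLimit.Theorems.SAWTotalPositivityCriticalBubbleBoundDockingEntropyZero

/-!
# Line `docking-census-joining` for the crux `SAWTotalPositivity.CriticalBubbleBound`
(stmt-CriticalPhenomena-7117), JOIN-MASS programme: re-rooting and the block transfer

Stubs `term_le_cterm` and `blockMass_term_le_of_jterm` of the lead's skeleton (c6, join-mass wave 1).
The crux's series is `Σ_n term n`, `term n = c_n(0,e₀) x_c^n` (ROOTED critical polygons); the programme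
bounds the CLASS masses `cterm n = #lexRooted n · x_c^{n+1}` (lex-rooted polygons: the root `0` is the
lowest-then-leftmost vertex, one walk per translation class) and their `17`-shifted sequence `jterm`.
This file converts between the two currencies:

* RE-ROOTING (`term_le_cterm`): every rooted polygon `P(ω')`, `ω' ∈ sawFun 2 n e₀`, `n ≥ 2`, has a
  lowest-then-leftmost vertex `b`, the edge `{b, b + e₀}` belongs to `P(ω')` (corner lemma) and every
  vertex of `P(ω') - b` is lexicographically nonnegative; the landed re-rooting count
  `Docking.card_sawFun_le_reroot` with `P = LexPos` gives `c_n(0,e₀) ≤ (n+1) · #lexRooted n`, whence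
  `term n ≤ (n+1) · x_c⁻¹ · cterm n`.
* BLOCK TRANSFER (`blockMass_term_le_of_jterm`): for `n ∈ B_i = [2^i, 2^{i+1})`, `i ≥ 4`,
  `term n ≤ 2^{i+1} x_c⁻¹ cterm n` and `cterm n = jterm (n + 17)` with `n + 17 ∈ B_i ∪ B_{i+1}`, so
  `Σ_{n ∈ B_i} cterm n ≤ R'_i + R'_{i+1}` (`R'_i = blockMass jterm i`); block bounds `R'_i ≤ C 2^{s i}`
  transfer to `blockMass term i ≤ C' 2^{(s+1) i}` (the finitely many `i < 4` go into the constant).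

Sources: N. Madras, G. Slade, *The Self-Avoiding Walk* (1993), §1.4, Definition 3.2.1–3.2.2;
A. Hammond, Ann. Probab. 46 (2018), §2.0.3. Elementary combinatorics ([folklore]).
-/

noncomputable section

open Literature.Probability.LatticeModels
open Literature.Probability.RandomPlanarGeometry Literature.Probability.RandomPlanarGeometry.SAW
open scoped BigOperators
open Summit.CriticalPhenomena.SAWScalingLimit.Theorems.CriticalBubbleBound.Negative (e₀)
open Summit.CriticalPhenomena.SAWScalingLimit.Theorems.CriticalBubbleBound.Docking

namespace Summit.CriticalPhenomena.SAWScalingLimit.Theorems.CriticalBubbleBound.Join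

/-! ## Re-rooting at the lowest-then-leftmost vertex -/

/-- The lowest-then-leftmost vertex `b` of the rooted polygon of `ω ∈ sawFun 2 n e₀` (`n ≥ 2`):
`{b, b + e₀}` is an edge of the polygon (corner lemma: `b - e₀` and `b - e₁` are not vertices) and
every vertex `x` satisfies `LexPos (x - b)`. [folklore] -/
theorem exists_lexMin_corner {n : ℕ} {ω : ℕ → Site 2} (hω : ω ∈ Zd.sawFun 2 n e₀) (hn : 2 ≤ n) :
    ∃ b ∈ verts n ω, s(b, b + e₀) ∈ pedges n ω ∧ ∀ x ∈ verts n ω, LexPos (x - b) := by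
  -- adapted from Docking.exists_bottom_corner (DockingEntropyZero), keeping the leftmost property
  obtain ⟨b, hb, hbmin, hbleft⟩ :=
    exists_max_left (S := verts n ω) ⟨ω 0, apply_mem_verts ω n.zero_le⟩ fun x => -x 1
  simp only [neg_le_neg_iff, neg_inj] at hbmin hbleft
  refine ⟨b, hb, mem_pedges_of_corner hω hn hb (fun h => ?_) (Or.inr fun h => ?_), fun x hx => ?_⟩
  · have h1 := hbleft _ h (by simp [e₀_e₁_apply])
    simp only [Pi.sub_apply, e₀_e₁_apply.1] at h1
    omega
  · have h1 := hbmin _ h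
    simp only [Pi.sub_apply, e₀_e₁_apply.2.2.2] at h1
    omega
  · have h1 := hbmin x hx
    unfold LexPos
    simp only [Pi.sub_apply]
    rcases h1.lt_or_eq with h2 | h2
    · exact Or.inl (by omega)
    · have h3 := hbleft x hx h2.symm
      exact Or.inr ⟨by omega, by omega⟩

/-- **Re-rooting count.** `c_n(0,e₀) ≤ (n+1) · #lexRooted n` for `n ≥ 2`: re-root every rooted
polygon at its lowest-then-leftmost vertex (`Docking.card_sawFun_le_reroot` with `P = LexPos`).
[cite: MadrasSlade1993, Definition 3.2.2] -/
theorem countAt_le_card_lexRooted {n : ℕ} (hn : 2 ≤ n) :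
    Zd.countAt 2 n e₀ ≤ (n + 1) * (lexRooted n).card := by
  classical
  have h := card_sawFun_le_reroot hn LexPos fun ω' hω' => exists_lexMin_corner hω' hn
  have hE : ((Zd.sawFun 2 n e₀).filter fun χ => ∀ m ≤ n, LexPos (χ m)) = lexRooted n := by
    ext χ
    rw [Finset.mem_filter, mem_lexRooted]
  rw [Zd.card_sawFun, hE] at h
  exact h

/-- **Stub `term_le_cterm`.** In crux currency: `term n ≤ (n+1) · x_c⁻¹ · cterm n` for `n ≥ 2`
(`term n = c_n(0,e₀) x_c^n`, `cterm n = #lexRooted n · x_c^{n+1}`, and the re-rooting count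
`c_n(0,e₀) ≤ (n+1) · #lexRooted n`). [cite: MadrasSlade1993, Definition 3.2.2] -/
theorem term_le_cterm : ∀ n : ℕ, 2 ≤ n → term n ≤ ((n : ℝ) + 1) * criticalFugacity⁻¹ * cterm n := by
  intro n hn
  have hx := criticalFugacity_pos_lt_one'.1
  have h' : (Zd.countAt 2 n e₀ : ℝ) ≤ ((n : ℝ) + 1) * ((lexRooted n).card : ℝ) := by
    exact_mod_cast countAt_le_card_lexRooted hn
  have hxx : criticalFugacity⁻¹ * criticalFugacity ^ (n + 1) = criticalFugacity ^ n := by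
    rw [pow_succ', ← mul_assoc, inv_mul_cancel₀ hx.ne', one_mul]
  rw [term, cterm]
  calc (Zd.countAt 2 n e₀ : ℝ) * criticalFugacity ^ n
      ≤ ((n : ℝ) + 1) * ((lexRooted n).card : ℝ) * criticalFugacity ^ n :=
        mul_le_mul_of_nonneg_right h' (pow_nonneg hx.le n)
    _ = ((n : ℝ) + 1) * criticalFugacity⁻¹ *
          (((lexRooted n).card : ℝ) * criticalFugacity ^ (n + 1)) := by
        rw [← hxx]; ring

/-! ## Block transfer from the shifted class sequence to the rooted terms -/

/-- Un-shifting on a block: for `i ≥ 4` (so that `2^{i+1} + 17 ≤ 2^{i+2}`),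
`Σ_{n ∈ B_i} cterm n = Σ_{n ∈ B_i} jterm (n + 17) ≤ blockMass jterm i + blockMass jterm (i+1)`.
[folklore] -/
theorem sum_block_cterm_le {i : ℕ} (hi : 4 ≤ i) :
    ∑ n ∈ block i, cterm n ≤ blockMass jterm i + blockMass jterm (i + 1) := by
  have h1 : ∑ n ∈ block i, cterm n =
      ∑ m ∈ Finset.Ico (2 ^ i + joinShift) (2 ^ (i + 1) + joinShift), jterm m := by
    rw [← Finset.sum_Ico_add', block]
    exact Finset.sum_congr rfl fun n _ => by
      rw [jterm_of_le (Nat.le_add_left _ _), Nat.add_sub_cancel]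
  have h2 : blockMass jterm i + blockMass jterm (i + 1) =
      ∑ m ∈ Finset.Ico (2 ^ i) (2 ^ (i + 1 + 1)), jterm m := by
    rw [blockMass_eq, blockMass_eq]
    exact Finset.sum_Ico_consecutive _ (Nat.pow_le_pow_right (by norm_num) (Nat.le_succ i))
      (Nat.pow_le_pow_right (by norm_num) (Nat.le_succ (i + 1)))
  have h16 : 16 ≤ 2 ^ i :=
    calc (16 : ℕ) = 2 ^ 4 := by norm_num
      _ ≤ 2 ^ i := Nat.pow_le_pow_right (by norm_num) hi
  have hp1 : 2 ^ (i + 1) = 2 * 2 ^ i := by rw [pow_succ, mul_comm]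
  have hp2 : 2 ^ (i + 1 + 1) = 2 * (2 * 2 ^ i) := by rw [pow_succ, pow_succ]; ring
  have hj : joinShift = 17 := rfl
  rw [h1, h2]
  refine Finset.sum_le_sum_of_subset_of_nonneg (fun m hm => ?_) fun m _ _ => jterm_nonneg m
  rw [Finset.mem_Ico] at hm ⊢
  omega

/-- **Stub `blockMass_term_le_of_jterm`.** Block bounds of the shifted class sequence transfer to
the crux's rooted blocks with one extra power of `2^i`: if `blockMass jterm i ≤ C 2^{s i}` for all
`i`, then `blockMass term i ≤ C' 2^{(s+1) i}` for all `i`, with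
`C' = 2 x_c⁻¹ C (1 + 2^s) + Σ_{i<4} blockMass term i / 2^{(s+1) i}` (for `i ≥ 4`:
`term n ≤ 2^{i+1} x_c⁻¹ cterm n` on `B_i` and `Σ_{B_i} cterm ≤ R'_i + R'_{i+1}`).
[cite: MadrasSlade1993, §1.4] -/
theorem blockMass_term_le_of_jterm : ∀ (C s : ℝ), (∀ i : ℕ, blockMass jterm i ≤ C * (2 : ℝ) ^ (s * (i : ℝ))) → ∃ C' : ℝ, ∀ i : ℕ, blockMass term i ≤ C' * (2 : ℝ) ^ ((s + 1) * (i : ℝ)) := by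
  intro C s hC
  have hx := criticalFugacity_pos_lt_one'.1
  have hμ0 : 0 ≤ criticalFugacity⁻¹ := inv_nonneg.2 hx.le
  have hC0 : 0 ≤ C := by
    have h0 := hC 0
    simp only [Nat.cast_zero, mul_zero, Real.rpow_zero, mul_one] at h0
    exact (blockMass_nonneg jterm_nonneg 0).trans h0
  refine ⟨2 * criticalFugacity⁻¹ * C * (1 + (2 : ℝ) ^ s) +
    ∑ j ∈ Finset.range 4, blockMass term j / (2 : ℝ) ^ ((s + 1) * (j : ℝ)), fun i => ?_⟩
  set A : ℝ := 2 * criticalFugacity⁻¹ * C * (1 + (2 : ℝ) ^ s) with hA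
  set B : ℝ := ∑ j ∈ Finset.range 4, blockMass term j / (2 : ℝ) ^ ((s + 1) * (j : ℝ)) with hB
  have hpow : 0 < (2 : ℝ) ^ ((s + 1) * (i : ℝ)) := Real.rpow_pos_of_pos two_pos _
  have hA0 : 0 ≤ A := mul_nonneg (mul_nonneg (mul_nonneg zero_le_two hμ0) hC0) (by positivity)
  have hBj : ∀ j ∈ Finset.range 4, 0 ≤ blockMass term j / (2 : ℝ) ^ ((s + 1) * (j : ℝ)) :=
    fun j _ => div_nonneg (blockMass_nonneg term_nonneg j) (Real.rpow_pos_of_pos two_pos _).le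
  have hB0 : 0 ≤ B := Finset.sum_nonneg hBj
  rcases Nat.lt_or_ge i 4 with hi | hi
  · -- finitely many small scales: absorbed in the constant `B`
    have hle : blockMass term i / (2 : ℝ) ^ ((s + 1) * (i : ℝ)) ≤ B :=
      Finset.single_le_sum (f := fun j => blockMass term j / (2 : ℝ) ^ ((s + 1) * (j : ℝ))) hBj
        (Finset.mem_range.2 hi)
    calc blockMass term i
        = blockMass term i / (2 : ℝ) ^ ((s + 1) * (i : ℝ)) * (2 : ℝ) ^ ((s + 1) * (i : ℝ)) :=
          (div_mul_cancel₀ _ hpow.ne').symm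
      _ ≤ (A + B) * (2 : ℝ) ^ ((s + 1) * (i : ℝ)) :=
          mul_le_mul_of_nonneg_right (by linarith) hpow.le
  · -- large scales: re-rooting on the block and un-shifting
    have h16 : 16 ≤ 2 ^ i :=
      calc (16 : ℕ) = 2 ^ 4 := by norm_num
        _ ≤ 2 ^ i := Nat.pow_le_pow_right (by norm_num) hi
    have h2 : ∀ n ∈ block i, term n ≤ (2 : ℝ) ^ (i + 1) * criticalFugacity⁻¹ * cterm n := by
      intro n hn
      rw [block, Finset.mem_Ico] at hn
      have hn2 : 2 ≤ n := by omega
      refine (term_le_cterm n hn2).trans ?_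
      refine mul_le_mul_of_nonneg_right (mul_le_mul_of_nonneg_right ?_ hμ0) (cterm_nonneg n)
      have h3 : n + 1 ≤ 2 ^ (i + 1) := Nat.succ_le_of_lt hn.2
      exact_mod_cast h3
    have e1 : (2 : ℝ) ^ (s * ((i + 1 : ℕ) : ℝ)) = (2 : ℝ) ^ (s * (i : ℝ)) * (2 : ℝ) ^ s := by
      rw [Nat.cast_succ, mul_add, mul_one, Real.rpow_add two_pos]
    have e2 : (2 : ℝ) ^ ((s + 1) * (i : ℝ)) = (2 : ℝ) ^ (s * (i : ℝ)) * (2 : ℝ) ^ i := by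
      rw [add_mul, one_mul, Real.rpow_add two_pos, Real.rpow_natCast]
    have hK : 0 ≤ (2 : ℝ) ^ (i + 1) * criticalFugacity⁻¹ := mul_nonneg (pow_nonneg zero_le_two _) hμ0
    calc blockMass term i = ∑ n ∈ block i, term n := rfl
      _ ≤ ∑ n ∈ block i, (2 : ℝ) ^ (i + 1) * criticalFugacity⁻¹ * cterm n := Finset.sum_le_sum h2
      _ = (2 : ℝ) ^ (i + 1) * criticalFugacity⁻¹ * ∑ n ∈ block i, cterm n := by rw [Finset.mul_sum]
      _ ≤ (2 : ℝ) ^ (i + 1) * criticalFugacity⁻¹ * (blockMass jterm i + blockMass jterm (i + 1)) :=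
          mul_le_mul_of_nonneg_left (sum_block_cterm_le hi) hK
      _ ≤ (2 : ℝ) ^ (i + 1) * criticalFugacity⁻¹ *
            (C * (2 : ℝ) ^ (s * (i : ℝ)) + C * (2 : ℝ) ^ (s * ((i + 1 : ℕ) : ℝ))) :=
          mul_le_mul_of_nonneg_left (add_le_add (hC i) (hC (i + 1))) hK
      _ = A * (2 : ℝ) ^ ((s + 1) * (i : ℝ)) := by
          rw [e1, e2, hA, pow_succ]
          ring
      _ ≤ (A + B) * (2 : ℝ) ^ ((s + 1) * (i : ℝ)) :=
          mul_le_mul_of_nonneg_right (by linarith) hpow.le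

end Summit.CriticalPhenomena.SAWScalingLimit.Theorems.CriticalBubbleBound.Join

end
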